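import Summits.ResolutionOfSingularities.ResolutionOfSingularities.Theorems.WeightedInvariantKeyRungThreeOfDropCurvePoint
import Summits.ResolutionOfSingularities.ResolutionOfSingularities.Theorems.WeightedInvariantIota3DropTypeA
import Summits.ResolutionOfSingularities.ResolutionOfSingularities.Theorems.WeightedInvariantHypersurfaceLocalGameEFTDimTwoFaceCone
import HarnessLib

/-!
# (D-b³-point) ⟸ (D-b³-point-STAT): at a closed-point centre only the ORDER-STATIONARY `t`-homogeneous successors matter
# (door `HypersurfaceCentreConstruction`, stmt-ResolutionOfSingularities-19897, stub `stub_keyRungGrHomLE_three`)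

Helper for `stub_keyRungGrHomLE_three` (def-free, `--supports 19897`).  After …KeyRungThreeOfDropCurvePoint (this hand: (NONREACH-K) holds, the curve
regime of (D-b³) is closed) the gap list of record is hD + (D-b³-point).  First cut of the POINT regime, the analogue of hand -9's «order drop ∨ tie»
dichotomy for curves: the first letter of `ι₃ᵗ` is the order, so a `t`-homogeneous successor `𝔫` of a closed-point centre at which the saturated
transform has order `< ν = ord_S f` (`g/1 ∉ 𝔪_𝔫^ν`) drops `ι₃ᵗ` for free (`iotaOrd_lt_of_notMem_pow`, `iotaFlatT_lt_of_iotaOrd_lt`).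

* **`Iota3.point_of_pointStat`** — (D-b³-point) ⟸ **(D-b³-point-STAT)**: the same statement with the extra hypotheses `f ∈ 𝔪^ν ∖ 𝔪^{ν+1}` and
  `g/1 ∈ 𝔪_𝔫^ν` (ORDER STATIONARY successor).
* **`keyRungGrHomLE_three_of_tieDescent_pointStat`** / **`keyRungGrHomLE_three_of_c11_pointStat`** — GAP LISTS: hD (resp. (c11)≤3) + (D-b³-point-STAT).

What (D-b³-point-STAT) is about (orientation for the next hand, not used in the proofs): modulo `t⁻¹` the transform `g` is the INITIAL FORM
`F = in_J(f)` in the weighted polynomial ring `gr_J(S) = κ[U₁,U₂,U₃]` (all weights positive at a point centre; chart `rho` of …LocalGameEFTPointMoveChart),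
and `ord_𝔫(g/1) ≤ ord_{𝔫̄}(F)`; order stationarity at a height-one homogeneous prime `𝔫̄ = (G)` means `G^ν ∣ F` — the weighted analogue of «the tangent
cone is a `ν`-fold hyperplane» (dimension two: `LocalGameEFTFace.iotaOrd_face_lt`, `iotaOrd_lt_of_isHomogeneous`), which the lex-maximality built into
`J₃ᵗ` must exclude or route to the later letters `(ε, τ, σ)` of `ι₃ᵗ`; the tools …IsolatedCoefficient / …SupportedUnitExpansion / …NonreachKTransport of
this hand are centre-agnostic and read such faces on unit expansions.

[OURS · L1 W4.3 · audit glue; AI work, weaker than expert review; nothing here is a statement of the manuscript under review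
(Hironaka 2017, [claim: Hironaka2017, status: under-review]).]

## References

* H. Hironaka, *Characteristic polyhedra of singularities*, J. Math. Kyoto Univ. 7 (1967), §3. [Hironaka1967]
* J. Włodarczyk, *Functorial resolution by torus actions*, arXiv:2203.03090, §2.3.9. [Wlodarczyk2022]
-/

noncomputable section

set_option linter.dupNamespace false -- mandated namespace of this single-conjunct summit

open IsLocalRing Literature.AlgebraicGeometry.Resolution
open Summit.ResolutionOfSingularities.ResolutionOfSingularities.Theorems
open Summit.ResolutionOfSingularities.ResolutionOfSingularities.Theorems.ContactCylinder
open Summit.ResolutionOfSingularities.ResolutionOfSingularities.Cruxes.HypersurfaceCentreConstruction.LocalEngine.Iota3.RatContact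

namespace Summit.ResolutionOfSingularities.ResolutionOfSingularities.Cruxes.HypersurfaceCentreConstruction.LocalEngine

namespace Iota3

/-- **(D-b³-point) ⟸ (D-b³-point-STAT)**: at a `t`-homogeneous successor of a closed-point centre where the ORDER of the saturated transform is
`< ord_S f`, `ι₃ᵗ` drops by its first letter; only the order-stationary successors remain. [OURS · L1 W4.3 · audit glue] -/
theorem point_of_pointStat (p : ℕ)
    (hSTAT : ∀ (k₀ : Type) [Field k₀] [CharP k₀ p] [PerfectField k₀]
      (S : Type) [CommRing S] [Algebra k₀ S] [Algebra.EssFiniteType k₀ S] [IsRegularLocalRing S]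
      (f : S), ringKrullDim S = 3 → f ≠ 0 → f ∈ (maximalIdeal S) ^ 2 →
      ∀ (P : Ideal S) [P.IsPrime], IsRegularLocalRing (S ⧸ P) → f ∈ P →
        topStratum iotaOrdEpsTau S f = {𝔮 | P ≤ 𝔮.asIdeal} → ¬ ringKrullDim (Localization.AtPrime P) ≤ 1 →
        P = maximalIdeal S →
        ∀ (n : ℕ) (u : Fin n → S) (w : Fin n → ℕ),
          Ideal.span (Set.range u) = maximalIdeal S → (maximalIdeal S).spanFinrank = n → (∃ i, 0 < w i) →
          Ideal.span {x | ∃ i, 0 < w i ∧ x = u i} = P →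
          (∀ m : ℕ, weightedMonomialIdeal u w m = jFlatT S f m) →
          ∀ (𝔫 : Ideal (cobordantAlgebra' u w)) [𝔫.IsPrime], IsTHomogeneous u w 𝔫 → cobordantT' u w ∈ 𝔫 →
            (maximalIdeal S).map (algebraMap S (cobordantAlgebra' u w)) ≤ 𝔫 →
            ¬ extReesAlgebra.vertexIdeal (weightedMonomialIdeal u w) ≤ 𝔫 →
            ∀ (a : ℕ) (g : cobordantAlgebra' u w), algebraMap S (cobordantAlgebra' u w) f = cobordantT' u w ^ a * g →
              ¬ cobordantT' u w ∣ g →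
              algebraMap (cobordantAlgebra' u w) (Localization.AtPrime 𝔫) g ∈ maximalIdeal (Localization.AtPrime 𝔫) ^ 2 →
              ∀ ν : ℕ, f ∈ maximalIdeal S ^ ν → f ∉ maximalIdeal S ^ (ν + 1) →
                algebraMap (cobordantAlgebra' u w) (Localization.AtPrime 𝔫) g ∈ maximalIdeal (Localization.AtPrime 𝔫) ^ ν →
              iotaFlatT (Localization.AtPrime 𝔫) (algebraMap (cobordantAlgebra' u w) (Localization.AtPrime 𝔫) g) <
                iotaFlatT S f) :
    ∀ (k₀ : Type) [Field k₀] [CharP k₀ p] [PerfectField k₀]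
      (S : Type) [CommRing S] [Algebra k₀ S] [Algebra.EssFiniteType k₀ S] [IsRegularLocalRing S]
      (f : S), ringKrullDim S = 3 → f ≠ 0 → f ∈ (maximalIdeal S) ^ 2 →
      ∀ (P : Ideal S) [P.IsPrime], IsRegularLocalRing (S ⧸ P) → f ∈ P →
        topStratum iotaOrdEpsTau S f = {𝔮 | P ≤ 𝔮.asIdeal} → ¬ ringKrullDim (Localization.AtPrime P) ≤ 1 →
        P = maximalIdeal S →
        ∀ (n : ℕ) (u : Fin n → S) (w : Fin n → ℕ),
          Ideal.span (Set.range u) = maximalIdeal S → (maximalIdeal S).spanFinrank = n → (∃ i, 0 < w i) →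
          Ideal.span {x | ∃ i, 0 < w i ∧ x = u i} = P →
          (∀ m : ℕ, weightedMonomialIdeal u w m = jFlatT S f m) →
          ∀ (𝔫 : Ideal (cobordantAlgebra' u w)) [𝔫.IsPrime], IsTHomogeneous u w 𝔫 → cobordantT' u w ∈ 𝔫 →
            (maximalIdeal S).map (algebraMap S (cobordantAlgebra' u w)) ≤ 𝔫 →
            ¬ extReesAlgebra.vertexIdeal (weightedMonomialIdeal u w) ≤ 𝔫 →
            ∀ (a : ℕ) (g : cobordantAlgebra' u w), algebraMap S (cobordantAlgebra' u w) f = cobordantT' u w ^ a * g →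
              ¬ cobordantT' u w ∣ g →
              algebraMap (cobordantAlgebra' u w) (Localization.AtPrime 𝔫) g ∈ maximalIdeal (Localization.AtPrime 𝔫) ^ 2 →
              iotaFlatT (Localization.AtPrime 𝔫) (algebraMap (cobordantAlgebra' u w) (Localization.AtPrime 𝔫) g) <
                iotaFlatT S f := by
  intro k₀ _ _ _ S _ _ _ _ f hd hf0 hf2 P _ hreg hfP hE hP1 hPm n u w h1 h2 h3 h4 h5 𝔫 _ hhom hT hM hV a g hfg hTg hg2
  haveI : IsDomain S := isDomain_of_isRegularLocalRing S
  -- the order `ν` of `f`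
  obtain ⟨ν, hν⟩ := Ordinal.lt_omega0.mp (iotaOrd_lt_omega0_of_ne_zero S hf0)
  obtain ⟨hfν, hfν1⟩ := (iotaOrd_eq_natCast_iff S f ν).mp hν
  by_cases hg : algebraMap (cobordantAlgebra' u w) (Localization.AtPrime 𝔫) g ∈ maximalIdeal (Localization.AtPrime 𝔫) ^ ν
  · exact hSTAT k₀ S f hd hf0 hf2 P hreg hfP hE hP1 hPm n u w h1 h2 h3 h4 h5 𝔫 hhom hT hM hV a g hfg hTg hg2 ν hfν hfν1 hg
  · apply iotaFlatT_lt_of_iotaOrd_lt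
    rw [hν]
    exact LocalGameEFTFace.iotaOrd_lt_of_notMem_pow hg

/-- **GAP LIST for `stub_keyRungGrHomLE_three` — hD + (D-b³-point-STAT).** [OURS · L1 W4.3 · audit glue] -/
theorem keyRungGrHomLE_three_of_tieDescent_pointStat (p : ℕ)
    (hD : ∀ (T T' : Type) [CommRing T] [IsRegularLocalRing T] [CommRing T'] [IsRegularLocalRing T'] [Algebra T T']
      [IsLocalHom (algebraMap T T')] [Algebra.FormallySmooth T T'] [Algebra.EssFiniteType T T'] (g : T),
      ringKrullDim T' ≤ 3 → IsTiePosition T' (algebraMap T T' g) → IsTiePosition T g)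
    (hSTAT : ∀ (k₀ : Type) [Field k₀] [CharP k₀ p] [PerfectField k₀]
      (S : Type) [CommRing S] [Algebra k₀ S] [Algebra.EssFiniteType k₀ S] [IsRegularLocalRing S]
      (f : S), ringKrullDim S = 3 → f ≠ 0 → f ∈ (maximalIdeal S) ^ 2 →
      ∀ (P : Ideal S) [P.IsPrime], IsRegularLocalRing (S ⧸ P) → f ∈ P →
        topStratum iotaOrdEpsTau S f = {𝔮 | P ≤ 𝔮.asIdeal} → ¬ ringKrullDim (Localization.AtPrime P) ≤ 1 →
        P = maximalIdeal S →
        ∀ (n : ℕ) (u : Fin n → S) (w : Fin n → ℕ),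
          Ideal.span (Set.range u) = maximalIdeal S → (maximalIdeal S).spanFinrank = n → (∃ i, 0 < w i) →
          Ideal.span {x | ∃ i, 0 < w i ∧ x = u i} = P →
          (∀ m : ℕ, weightedMonomialIdeal u w m = jFlatT S f m) →
          ∀ (𝔫 : Ideal (cobordantAlgebra' u w)) [𝔫.IsPrime], IsTHomogeneous u w 𝔫 → cobordantT' u w ∈ 𝔫 →
            (maximalIdeal S).map (algebraMap S (cobordantAlgebra' u w)) ≤ 𝔫 →
            ¬ extReesAlgebra.vertexIdeal (weightedMonomialIdeal u w) ≤ 𝔫 →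
            ∀ (a : ℕ) (g : cobordantAlgebra' u w), algebraMap S (cobordantAlgebra' u w) f = cobordantT' u w ^ a * g →
              ¬ cobordantT' u w ∣ g →
              algebraMap (cobordantAlgebra' u w) (Localization.AtPrime 𝔫) g ∈ maximalIdeal (Localization.AtPrime 𝔫) ^ 2 →
              ∀ ν : ℕ, f ∈ maximalIdeal S ^ ν → f ∉ maximalIdeal S ^ (ν + 1) →
                algebraMap (cobordantAlgebra' u w) (Localization.AtPrime 𝔫) g ∈ maximalIdeal (Localization.AtPrime 𝔫) ^ ν →
              iotaFlatT (Localization.AtPrime 𝔫) (algebraMap (cobordantAlgebra' u w) (Localization.AtPrime 𝔫) g) <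
                iotaFlatT S f) : KeyRungGrHomLE 3 p :=
  keyRungGrHomLE_three_of_tieDescent_point p hD (point_of_pointStat p hSTAT)

/-- **GAP LIST, (c11)-form — (c11)≤3 + (D-b³-point-STAT).** [OURS · L1 W4.3 · audit glue] -/
theorem keyRungGrHomLE_three_of_c11_pointStat (p : ℕ) (hc11 : IotaJEssSmoothCompatibleLE 3 iotaFlatT jFlatT)
    (hSTAT : ∀ (k₀ : Type) [Field k₀] [CharP k₀ p] [PerfectField k₀]
      (S : Type) [CommRing S] [Algebra k₀ S] [Algebra.EssFiniteType k₀ S] [IsRegularLocalRing S]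
      (f : S), ringKrullDim S = 3 → f ≠ 0 → f ∈ (maximalIdeal S) ^ 2 →
      ∀ (P : Ideal S) [P.IsPrime], IsRegularLocalRing (S ⧸ P) → f ∈ P →
        topStratum iotaOrdEpsTau S f = {𝔮 | P ≤ 𝔮.asIdeal} → ¬ ringKrullDim (Localization.AtPrime P) ≤ 1 →
        P = maximalIdeal S →
        ∀ (n : ℕ) (u : Fin n → S) (w : Fin n → ℕ),
          Ideal.span (Set.range u) = maximalIdeal S → (maximalIdeal S).spanFinrank = n → (∃ i, 0 < w i) →
          Ideal.span {x | ∃ i, 0 < w i ∧ x = u i} = P →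
          (∀ m : ℕ, weightedMonomialIdeal u w m = jFlatT S f m) →
          ∀ (𝔫 : Ideal (cobordantAlgebra' u w)) [𝔫.IsPrime], IsTHomogeneous u w 𝔫 → cobordantT' u w ∈ 𝔫 →
            (maximalIdeal S).map (algebraMap S (cobordantAlgebra' u w)) ≤ 𝔫 →
            ¬ extReesAlgebra.vertexIdeal (weightedMonomialIdeal u w) ≤ 𝔫 →
            ∀ (a : ℕ) (g : cobordantAlgebra' u w), algebraMap S (cobordantAlgebra' u w) f = cobordantT' u w ^ a * g →
              ¬ cobordantT' u w ∣ g →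
              algebraMap (cobordantAlgebra' u w) (Localization.AtPrime 𝔫) g ∈ maximalIdeal (Localization.AtPrime 𝔫) ^ 2 →
              ∀ ν : ℕ, f ∈ maximalIdeal S ^ ν → f ∉ maximalIdeal S ^ (ν + 1) →
                algebraMap (cobordantAlgebra' u w) (Localization.AtPrime 𝔫) g ∈ maximalIdeal (Localization.AtPrime 𝔫) ^ ν →
              iotaFlatT (Localization.AtPrime 𝔫) (algebraMap (cobordantAlgebra' u w) (Localization.AtPrime 𝔫) g) <
                iotaFlatT S f) : KeyRungGrHomLE 3 p :=
  keyRungGrHomLE_three_of_c11_point p hc11 (point_of_pointStat p hSTAT)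

end Iota3

end Summit.ResolutionOfSingularities.ResolutionOfSingularities.Cruxes.HypersurfaceCentreConstruction.LocalEngine

end
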